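import Summits.QuantumAdvantage.AdviceFreeQNC0.WalkHardFFewReaders
import Summits.QuantumAdvantage.AdviceFreeQNC0.WindowLocalHard
import HarnessLib

/-!
# The junta corollary of rung R8: every strategy with polylog-junta CUTS loses the u-walk game (every prime `p ≠ 3`)

Planner qa-qnc0-p2 g15, ROUND-15 (p2) §3.7 / `line15/Sketch15R7.lean` (def `WalkHardFJunta` VERBATIM below): a strategy for α's
u-walk game `ringWinU c y` each of whose cuts `y_g` depends on at most `(log₂ n)^C` input bits — anywhere, no locality and no degree
hypothesis — wins on at most `θ·2ⁿ` inputs, `θ = 1 − η₀(p)/4`.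

PROOF (pigeonhole over R8).  A `J`-junta has `𝔽_p`-degree `≤ |J|` (g8's junta-degree lemma `ind_mem_lowDeg_of_dependsOn`).  Reader
incidences: `Σ_{a<n−1} #{g : a ∈ J_g ∨ a+1 ∈ J_g} ≤ 2·Σ_g |J_g| ≤ 2(n+1)(log₂ n)^C`, so some adjacent pair `(a, a+1)` is read by at most
`3(log₂ n)^C ≤ (log₂ n)^{C+2}` cuts IN TOTAL; these are the exceptional readers `S` of `WalkHardFFewReaders` (with `w = 0`), and every
other cut does not read the pair.  Main results: `walkHardFJuntaCuts_of_fewReaders : WalkHardFFewReaders p → WalkHardFJunta p`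
(every prime, pure combinatorics) and `walkHardFJuntaCuts (p) (hp3 : p ≠ 3) : WalkHardFJunta p`.  (qn-prover g10's
`WalkHardFJunta.lean`/`walkHardFJunta` is the GLOBAL-junta special case — one set `J` read by all cuts — over R7; the planner's
def proved here lets every cut have its own polylog junta.)  This is the main-term input of the planner's rung R11
(`WalkHardFLinTests`, ROUND-15 §3.11).
WHAT THIS IS NOT: strategies with cuts of super-polylog fan-in (mod-`p` counters) are untouched; rung F-Q2-odd instrument; separation
NOT moved.
-/

namespace Summit.QuantumAdvantage.AdviceFreeQNC0

open Finset Literature.Computability.MetaComplexity Literature.Computability.MetaComplexity.Hegedus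
open Literature.Computability.MetaComplexity.Smolensky

/-- **`WalkHardFJunta p`** (planner qa-qnc0-p2 g15 Sketch15R7, verbatim): a strategy each of whose cuts depends on at most
`(log₂ n)^C` input bits (anywhere — no locality, no degree hypothesis needed: a `m`-junta has `𝔽_p`-degree ≤ `m`) wins on at
most `θ·2ⁿ` inputs. -/
def WalkHardFJunta (p : ℕ) [Fact p.Prime] : Prop :=
  ∃ θ : ℝ, θ < 1 ∧ ∀ C : ℕ, ∃ n₀ : ℕ, ∀ n ≥ n₀, ∀ c : ℕ,
    ∀ y : Fin (n + 1) → (Fin n → Bool) → Bool,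
      (∀ g, ∃ J : Finset (Fin n), J.card ≤ (Nat.log 2 n) ^ C ∧
          ∀ u v : Fin n → Bool, (∀ i ∈ J, u i = v i) → y g u = y g v) →
        ((Finset.univ.filter fun u : Fin n → Bool => ringWinU c y u = true).card : ℝ) ≤ θ * (2 : ℝ) ^ n

namespace Junta

variable {n : ℕ}

/-- Reader incidences of one bit position: `Σ_{a<n} #{g : some j ∈ J_g has j = a} = Σ_g |J_g|`. -/
theorem sum_card_readers_eq (J : Fin (n + 1) → Finset (Fin n)) :
    (∑ a ∈ range n, (univ.filter fun g : Fin (n + 1) => ∃ j ∈ J g, j.val = a).card) =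
      ∑ g : Fin (n + 1), (J g).card := by
  classical
  have h1 : ∀ a, (univ.filter fun g : Fin (n + 1) => ∃ j ∈ J g, j.val = a).card =
      ∑ g : Fin (n + 1), if (∃ j ∈ J g, j.val = a) then 1 else 0 := fun a => Finset.card_filter _ _
  simp_rw [h1]
  rw [Finset.sum_comm]
  refine Finset.sum_congr rfl fun g _ => ?_
  rw [← Finset.card_filter]
  have heq : ((range n).filter fun a => ∃ j ∈ J g, j.val = a) = (J g).image Fin.val := by
    ext a
    simp only [mem_filter, mem_range, Finset.mem_image]
    constructor
    · rintro ⟨_, j, hj, rfl⟩; exact ⟨j, hj, rfl⟩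
    · rintro ⟨j, hj, rfl⟩; exact ⟨j.isLt, j, hj, rfl⟩
  rw [heq, Finset.card_image_of_injective _ Fin.val_injective]

/-- **Pigeonhole on reader incidences**: if every `J_g` has at most `Λ` elements and `n ≥ 5`, some adjacent pair `(a, a+1)`,
`a + 2 ≤ n`, meets at most `3Λ` of the sets `J_g`. -/
theorem exists_pair_few_readers {Λ : ℕ} (hn : 5 ≤ n) (J : Fin (n + 1) → Finset (Fin n)) (hJ : ∀ g, (J g).card ≤ Λ) :
    ∃ a : ℕ, a + 2 ≤ n ∧
      (univ.filter fun g : Fin (n + 1) => ∃ j ∈ J g, j.val = a ∨ j.val = a + 1).card ≤ 3 * Λ := by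
  classical
  obtain ⟨m, rfl⟩ : ∃ m, n = m + 1 := ⟨n - 1, by omega⟩
  -- incidences of a single position, summed over all positions
  have htot : (∑ a ∈ range (m + 1), (univ.filter fun g : Fin (m + 1 + 1) => ∃ j ∈ J g, j.val = a).card) ≤
      (m + 1 + 1) * Λ := by
    rw [sum_card_readers_eq J]
    calc (∑ g : Fin (m + 1 + 1), (J g).card) ≤ ∑ _g : Fin (m + 1 + 1), Λ := Finset.sum_le_sum fun g _ => hJ g
      _ = (m + 1 + 1) * Λ := by simp
  -- pair incidences ≤ incidences at `a` + incidences at `a + 1`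
  have hpair : ∀ a, (univ.filter fun g : Fin (m + 1 + 1) => ∃ j ∈ J g, j.val = a ∨ j.val = a + 1).card ≤
      (univ.filter fun g : Fin (m + 1 + 1) => ∃ j ∈ J g, j.val = a).card +
      (univ.filter fun g : Fin (m + 1 + 1) => ∃ j ∈ J g, j.val = a + 1).card := by
    intro a
    refine le_trans (Finset.card_le_card fun g hg => ?_) (Finset.card_union_le _ _)
    rw [mem_filter] at hg
    rw [Finset.mem_union, mem_filter, mem_filter]
    obtain ⟨j, hj, h | h⟩ := hg.2
    · exact Or.inl ⟨mem_univ _, j, hj, h⟩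
    · exact Or.inr ⟨mem_univ _, j, hj, h⟩
  have hA : (∑ a ∈ range m, (univ.filter fun g : Fin (m + 1 + 1) => ∃ j ∈ J g, j.val = a).card) ≤ (m + 1 + 1) * Λ := by
    refine le_trans ?_ htot
    rw [Finset.sum_range_succ]
    exact Nat.le_add_right _ _
  have hB : (∑ a ∈ range m, (univ.filter fun g : Fin (m + 1 + 1) => ∃ j ∈ J g, j.val = a + 1).card) ≤
      (m + 1 + 1) * Λ := by
    refine le_trans ?_ htot
    rw [Finset.sum_range_succ']
    exact Nat.le_add_right _ _
  have hsum : (∑ a ∈ range m, (univ.filter fun g : Fin (m + 1 + 1) =>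
      ∃ j ∈ J g, j.val = a ∨ j.val = a + 1).card) ≤ 2 * ((m + 1 + 1) * Λ) := by
    calc (∑ a ∈ range m, (univ.filter fun g : Fin (m + 1 + 1) => ∃ j ∈ J g, j.val = a ∨ j.val = a + 1).card)
        ≤ ∑ a ∈ range m, ((univ.filter fun g : Fin (m + 1 + 1) => ∃ j ∈ J g, j.val = a).card +
            (univ.filter fun g : Fin (m + 1 + 1) => ∃ j ∈ J g, j.val = a + 1).card) :=
          Finset.sum_le_sum fun a _ => hpair a
      _ ≤ 2 * ((m + 1 + 1) * Λ) := by rw [Finset.sum_add_distrib]; omega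
  -- pigeonhole
  have hle : (∑ a ∈ range m, (univ.filter fun g : Fin (m + 1 + 1) =>
      ∃ j ∈ J g, j.val = a ∨ j.val = a + 1).card) ≤ ∑ _a ∈ range m, 3 * Λ := by
    refine hsum.trans ?_
    rw [Finset.sum_const, Finset.card_range, smul_eq_mul]
    have : 2 * (m + 1 + 1) ≤ 3 * m := by omega
    calc 2 * ((m + 1 + 1) * Λ) = (2 * (m + 1 + 1)) * Λ := by ring
      _ ≤ (3 * m) * Λ := Nat.mul_le_mul_right Λ this
      _ = m * (3 * Λ) := by ring
  obtain ⟨a, ha, hcard⟩ := Finset.exists_le_of_sum_le (Finset.nonempty_range_iff.2 (by omega)) hle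
  exact ⟨a, by rw [mem_range] at ha; omega, hcard⟩

end Junta

open Junta in
/-- **The junta corollary of R8** (every prime): `WalkHardFFewReaders p → WalkHardFJunta p`. -/
theorem walkHardFJuntaCuts_of_fewReaders (p : ℕ) [Fact p.Prime] (h : WalkHardFFewReaders p) : WalkHardFJunta p := by
  classical
  obtain ⟨θ, hθ, H⟩ := h
  refine ⟨θ, hθ, fun C => ?_⟩
  obtain ⟨n₀, hn₀⟩ := H (C + 2)
  refine ⟨max n₀ 5, fun n hn c y hy => ?_⟩
  have hn₀' : n₀ ≤ n := le_trans (le_max_left _ _) hn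
  have hn5 : 5 ≤ n := le_trans (le_max_right _ _) hn
  -- the juntas
  choose J hJcard hJdep using hy
  -- exponent bookkeeping: `3·(log₂ n)^C ≤ (log₂ n)^(C+2)` and `(log₂ n)^C ≤ (log₂ n)^(C+2)`
  have hlog2 : 2 ≤ Nat.log 2 n := Nat.le_log_of_pow_le one_lt_two (by omega)
  have hpow : 3 * Nat.log 2 n ^ C ≤ Nat.log 2 n ^ (C + 2) := by
    rw [pow_add]
    have : 3 ≤ Nat.log 2 n ^ 2 := le_trans (by norm_num) (Nat.pow_le_pow_left hlog2 2)
    calc 3 * Nat.log 2 n ^ C = Nat.log 2 n ^ C * 3 := by ring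
      _ ≤ Nat.log 2 n ^ C * Nat.log 2 n ^ 2 := Nat.mul_le_mul_left _ this
  have hpow' : Nat.log 2 n ^ C ≤ Nat.log 2 n ^ (C + 2) :=
    Nat.pow_le_pow_right (by omega) (by omega)
  -- degrees of juntas
  have hdeg : ∀ g, HasDegF p (y g) (Nat.log 2 n ^ (C + 2)) := fun g =>
    lowDeg_mono ((hJcard g).trans hpow') (ind_mem_lowDeg_of_dependsOn (F := ZMod p) (J g) (y g) (hJdep g))
  -- the pair with few readers
  obtain ⟨a, ha, hfew⟩ := exists_pair_few_readers hn5 J hJcard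
  refine hn₀ n hn₀' c 0 a (Nat.zero_le _) ha y hdeg
    (univ.filter fun g : Fin (n + 1) => ∃ j ∈ J g, j.val = a ∨ j.val = a + 1) (hfew.trans hpow) ?_
  -- non-readers do not read the pair
  intro g hg _ u v huv
  refine hJdep g u v fun i hi => huv i ?_ ?_
  · intro h; exact hg (mem_filter.2 ⟨mem_univ _, i, hi, Or.inl h⟩)
  · intro h; exact hg (mem_filter.2 ⟨mem_univ _, i, hi, Or.inr h⟩)

/-- **Every polylog-junta strategy loses the u-walk game — PROVED for every prime `p ≠ 3`.** -/
theorem walkHardFJuntaCuts (p : ℕ) [Fact p.Prime] (hp3 : p ≠ 3) : WalkHardFJunta p :=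
  walkHardFJuntaCuts_of_fewReaders p (walkHardFFewReaders p hp3)

end Summit.QuantumAdvantage.AdviceFreeQNC0
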